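import Summits.ResolutionOfSingularities.ResolutionOfSingularities.Theorems.WildConesCampaignW46TjurinaInvarianceOption
import Literature.RingTheory.MvPowerSeries.FrobeniusPowerBasis
import Literature.RingTheory.MvPowerSeries.FiniteColength
import Mathlib.FieldTheory.Perfect
import HarnessLib

/-!
# [OURS · L1 W4.6, rungs (i)/(ii) — the dictionary, SCHEME HALF, brick 14] The Tjurina algebra is intrinsic under
# ARBITRARY ring automorphisms of `κ⟦X⟧` over a perfect field of characteristic `p`
Cell res-hironaka (LADDER-RESOLUTION rung L, D-0089), slot W4.6, seat res-L1-s46-pv-2 (gen 3). Host: route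
`WildCones`, crux `ClassicalRegimes` (stmt-ResolutionOfSingularities-16884), `--supports … --as helper`.

HONEST FRAMING. Everything here is OURS and pure commutative algebra over Mathlib and this seat's bricks 11/11b
(`…TjurinaInvariance.lean`, `…TjurinaInvarianceOption.lean`). NOTHING here is a statement of H. Hironaka's manuscript
[Hironaka2017]; no FACT-LIST premise. AI review is weaker than expert review.

## Why (the clause «EVERY presentation is isolated» of the forced-atom class)

The rung `CampaignW46.ForcedAtom.terminates_of_le_forcedAtom` (p516034) states the forced-atom class with presentations
`E₀ : 𝒪̂_{Z,ξ} ≃+* κ⟦z,u⟧` that are RING isomorphisms (this is what the chart dictionary produces), and therefore asks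
isolatedness of EVERY presentation: two presentations differ by a ring automorphism `θ = E₀″ ∘ E₀′⁻¹` of `κ⟦X⟧`
and a unit, and brick 11 (`finite_tjurina_iff_of_algEquiv`) covers `κ`-ALGEBRA automorphisms only. This file removes
the restriction: over a PERFECT field `κ` of characteristic `p` every ring endomorphism of a power series ring maps
constants to constants (`ringHom_C`: the constants are exactly the series that are `p^ℓ`-th powers for every `ℓ`,
by the tree's Frobenius support lemma `isSupportedOnMultiples_of_exists_pow_eq` — Matsumura §30 — and perfectness),
so a ring automorphism `θ` is SEMILINEAR, `θ ∘ C = C ∘ s` for a field automorphism `s` (`exists_ringEquiv_forall_C`),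
and factors as `θ = θ′ ∘ map s` with `θ′` a `κ`-algebra automorphism (`exists_algEquiv_forall_eq`). Partial derivatives
commute with `map s` (`pd_map`), the Tjurina ideal is transported (`tjurina_map_eq_map`), and finiteness of a quotient
`κ⟦X⟧ ⧸ I` over `κ` is intrinsic (`finite_quotient_iff_exists_pow_le`: iff `𝔪^M ≤ I` for some `M`; hence invariant under
bijective ring endomorphisms, `finite_quotient_map_of_bijective`). Conclusion `finite_tjurina_iff_of_ringEquiv(_option)`:
for every ring automorphism `θ` of `κ⟦X⟧` and unit `w`, `κ⟦X⟧/T(w·θF)` is finite over `κ` iff `κ⟦X⟧/T(F)` is — so in the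
forced-atom class isolatedness of ONE presentation is isolatedness of all (brick 15, `…ForcedAtomIsolTransfer.lean`).

References: H. Matsumura, Commutative Ring Theory (1986), §30, proof of Thm. 30.9 (`k^p⟦x^p⟧ = B^p`) — through the
tree file `Literature/RingTheory/MvPowerSeries/FrobeniusPowerBasis.lean`; bricks 11/11b of this seat.
[cite: Matsumura1987, Thm. 30.9] [folklore]
-/

noncomputable section

-- single-problem summit: the doubled namespace component `ResolutionOfSingularities` is forced
set_option linter.dupNamespace false

open scoped BigOperators Classical
open MvPowerSeries IsLocalRing

namespace Summit.ResolutionOfSingularities.ResolutionOfSingularities.Theorems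

namespace CampaignW46.AtomGerm

open Literature.RingTheory.MvPowerSeries (pd coeff_pd IsSupportedOnMultiples isSupportedOnMultiples_of_exists_pow_eq)
open Literature.RingTheory.MvPowerSeries.Jets (exists_maximalIdeal_pow_le_of_finite_quotient
  finite_quotient_maximalIdeal_pow)

variable {κ : Type} [Field κ]

/-! ## Constants of `κ⟦X⟧` are the series that are `p^ℓ`-th powers for every `ℓ` -/

/-- In characteristic `p`, a power series that is a `p^ℓ`-th power for EVERY `ℓ` is a constant: a `p^ℓ`-th power is
supported on exponents divisible by `p^ℓ` (Matsumura §30), and no non-zero exponent is divisible by all `p^ℓ`.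
[cite: Matsumura1987, Thm. 30.9] -/
theorem eq_C_of_forall_exists_pow_eq (p : ℕ) [Fact p.Prime] [CharP κ p] {σ : Type} {ψ : MvPowerSeries σ κ}
    (h : ∀ ℓ : ℕ, ∃ f : MvPowerSeries σ κ, f ^ p ^ ℓ = ψ) : ψ = C (constantCoeff ψ) := by
  have hp : 1 < p := (Fact.out : p.Prime).one_lt
  ext m
  by_cases hm : m = 0
  · subst hm
    rw [coeff_zero_eq_constantCoeff_apply, coeff_zero_eq_constantCoeff_apply, constantCoeff_C]
  · obtain ⟨i, hi⟩ : ∃ i, m i ≠ 0 := by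
      by_contra h'
      push Not at h'
      exact hm (Finsupp.ext h')
    have hndvd : ¬ p ^ (m i) ∣ m i := fun hd =>
      absurd (Nat.le_of_dvd (Nat.pos_of_ne_zero hi) hd) (not_le.mpr (Nat.lt_pow_self hp))
    rw [isSupportedOnMultiples_of_exists_pow_eq p (h (m i)) m ⟨i, hndvd⟩, coeff_C, if_neg hm]

/-- Over a PERFECT field of characteristic `p`, a constant `C l` is a `p^ℓ`-th power for every `ℓ`. [folklore] -/
theorem exists_pow_eq_C (p : ℕ) [Fact p.Prime] [CharP κ p] [PerfectRing κ p] {σ : Type} (l : κ) (ℓ : ℕ) :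
    ∃ f : MvPowerSeries σ κ, f ^ p ^ ℓ = C l :=
  ⟨C ((iterateFrobeniusEquiv κ p ℓ).symm l), by
    rw [← map_pow, ← iterateFrobeniusEquiv_def, RingEquiv.apply_symm_apply]⟩

/-- **Ring homomorphisms between power series rings over a perfect field of characteristic `p` map constants to
constants**: `θ (C l) = C (constantCoeff (θ (C l)))` — `θ (C l)` is a `p^ℓ`-th power for every `ℓ`.
[cite: Matsumura1987, Thm. 30.9] -/
theorem ringHom_C (p : ℕ) [Fact p.Prime] [CharP κ p] [PerfectRing κ p] {σ τ : Type}
    (θ : MvPowerSeries σ κ →+* MvPowerSeries τ κ) (l : κ) :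
    θ (C l) = C (constantCoeff (θ (C l))) := by
  refine eq_C_of_forall_exists_pow_eq p fun ℓ => ?_
  obtain ⟨f, hf⟩ := exists_pow_eq_C p (σ := σ) l ℓ
  exact ⟨θ f, by rw [← map_pow, hf]⟩

/-- **A ring isomorphism of power series rings over a perfect field of characteristic `p` is semilinear**: there is a
field automorphism `s` of `κ` with `θ (C l) = C (s l)` for all `l`. [folklore] -/
theorem exists_ringEquiv_forall_C (p : ℕ) [Fact p.Prime] [CharP κ p] [PerfectRing κ p] {σ τ : Type}
    (θ : MvPowerSeries σ κ ≃+* MvPowerSeries τ κ) :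
    ∃ s : κ ≃+* κ, ∀ l, θ (C l) = C (s l) := by
  let s₁ : κ →+* κ := (constantCoeff (σ := τ) (R := κ)).comp ((θ : _ →+* _).comp (C (σ := σ) (R := κ)))
  let s₂ : κ →+* κ := (constantCoeff (σ := σ) (R := κ)).comp ((θ.symm : _ →+* _).comp (C (σ := τ) (R := κ)))
  have h₁ : ∀ l, θ (C l) = C (s₁ l) := fun l =>
    ringHom_C p (θ : MvPowerSeries σ κ →+* MvPowerSeries τ κ) l
  have h₂ : ∀ l, θ.symm (C l) = C (s₂ l) := fun l =>
    ringHom_C p (θ.symm : MvPowerSeries τ κ →+* MvPowerSeries σ κ) l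
  have h₂₁ : ∀ l, s₂ (s₁ l) = l := fun l => by
    have h := θ.symm_apply_apply (C l)
    rw [h₁, h₂] at h
    simpa only [constantCoeff_C] using congrArg (constantCoeff (σ := σ) (R := κ)) h
  have h₁₂ : ∀ l, s₁ (s₂ l) = l := fun l => by
    have h := θ.apply_symm_apply (C l)
    rw [h₂, h₁] at h
    simpa only [constantCoeff_C] using congrArg (constantCoeff (σ := τ) (R := κ)) h
  exact ⟨RingEquiv.ofBijective s₁ (Function.bijective_iff_has_inverse.mpr ⟨s₂, h₂₁, h₁₂⟩), h₁⟩

/-! ## `map` along a field automorphism -/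

/-- `map s⁻¹ (map s f) = f`. [folklore] -/
theorem map_symm_map {σ : Type} (s : κ ≃+* κ) (f : MvPowerSeries σ κ) :
    map (σ := σ) (s.symm : κ →+* κ) (map (σ := σ) (s : κ →+* κ) f) = f := by
  rw [← RingHom.comp_apply, ← map_comp, RingEquiv.symm_comp, map_id, RingHom.id_apply]

/-- `map s (map s⁻¹ f) = f`. [folklore] -/
theorem map_map_symm {σ : Type} (s : κ ≃+* κ) (f : MvPowerSeries σ κ) :
    map (σ := σ) (s : κ →+* κ) (map (σ := σ) (s.symm : κ →+* κ) f) = f := by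
  rw [← RingHom.comp_apply, ← map_comp, RingEquiv.comp_symm, map_id, RingHom.id_apply]

/-- `map` along a field automorphism is bijective. [folklore] -/
theorem map_bijective {σ : Type} (s : κ ≃+* κ) :
    Function.Bijective (map (σ := σ) (s : κ →+* κ)) :=
  ⟨Function.LeftInverse.injective (g := map (σ := σ) (s.symm : κ →+* κ)) (map_symm_map s),
    Function.RightInverse.surjective (g := map (σ := σ) (s.symm : κ →+* κ)) (map_map_symm s)⟩

/-- **Decomposition of a ring automorphism of `κ⟦X⟧`** (perfect `κ` of characteristic `p`): `θ = θ′ ∘ map s` with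
`s` a field automorphism of `κ` and `θ′` a `κ`-ALGEBRA automorphism. [folklore] -/
theorem exists_algEquiv_forall_eq (p : ℕ) [Fact p.Prime] [CharP κ p] [PerfectRing κ p] {σ : Type}
    (θ : MvPowerSeries σ κ ≃+* MvPowerSeries σ κ) :
    ∃ (s : κ ≃+* κ) (θ' : MvPowerSeries σ κ ≃ₐ[κ] MvPowerSeries σ κ),
      ∀ f, θ f = θ' (map (σ := σ) (s : κ →+* κ) f) := by
  obtain ⟨s, hs⟩ := exists_ringEquiv_forall_C p θ
  let θr : MvPowerSeries σ κ ≃+* MvPowerSeries σ κ :=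
    { toFun := fun f => θ (map (σ := σ) (s.symm : κ →+* κ) f)
      invFun := fun g => map (σ := σ) (s : κ →+* κ) (θ.symm g)
      left_inv := fun f => by
        simp only [RingEquiv.symm_apply_apply, map_map_symm]
      right_inv := fun g => by
        simp only [map_symm_map, RingEquiv.apply_symm_apply]
      map_mul' := fun f g => by simp only [map_mul]
      map_add' := fun f g => by simp only [map_add] }
  have hθr : ∀ l, θr (algebraMap κ (MvPowerSeries σ κ) l) = algebraMap κ (MvPowerSeries σ κ) l := fun l => by
    change θ (map (σ := σ) (s.symm : κ →+* κ) (algebraMap κ (MvPowerSeries σ κ) l)) = _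
    rw [← c_eq_algebraMap, map_C, RingEquiv.coe_toRingHom, hs, RingEquiv.apply_symm_apply]
  refine ⟨s, AlgEquiv.ofRingEquiv (f := θr) hθr, fun f => ?_⟩
  change θ f = θ (map (σ := σ) (s.symm : κ →+* κ) (map (σ := σ) (s : κ →+* κ) f))
  rw [map_symm_map]

/-! ## Partial derivatives and the Tjurina ideal under `map` -/

/-- Partial derivatives commute with `map` along a ring homomorphism of the coefficients. [folklore] -/
theorem pd_map {σ : Type} {S : Type} [CommSemiring S] (φ : κ →+* S) (i : σ) (F : MvPowerSeries σ κ) :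
    pd i (map (σ := σ) φ F) = map (σ := σ) φ (pd i F) := by
  ext e
  rw [coeff_pd, coeff_map, coeff_map, coeff_pd, map_mul, map_natCast]

/-- **The Tjurina ideal is transported by `map`**: `T(map φ F) = (map φ)(T(F))` as ideals. [folklore] -/
theorem tjurina_map_eq_map {σ : Type} (φ : κ →+* κ) (F : MvPowerSeries σ κ) :
    Ideal.span {map (σ := σ) φ F} ⊔ Ideal.span (Set.range fun i : σ => pd i (map (σ := σ) φ F)) =
      (Ideal.span {F} ⊔ Ideal.span (Set.range fun i : σ => pd i F)).map (map (σ := σ) φ) := by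
  have hcomp : (fun i : σ => pd i (map (σ := σ) φ F)) = (map (σ := σ) φ) ∘ (fun i : σ => pd i F) := by
    funext i
    exact pd_map φ i F
  rw [Ideal.map_sup, Ideal.map_span, Set.image_singleton, Ideal.map_span, ← Set.range_comp, hcomp]

/-! ## Finiteness of `κ⟦X⟧ ⧸ I` over `κ` is intrinsic -/

/-- `κ⟦X⟧ ⧸ I` is finite over `κ` iff `𝔪^M ≤ I` for some `M` (finitely many variables). [folklore] -/
theorem finite_quotient_iff_exists_pow_le {σ : Type} [Finite σ] (I : Ideal (MvPowerSeries σ κ)) :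
    Module.Finite κ (MvPowerSeries σ κ ⧸ I) ↔ ∃ M : ℕ, maximalIdeal (MvPowerSeries σ κ) ^ M ≤ I := by
  constructor
  · intro h
    exact exists_maximalIdeal_pow_le_of_finite_quotient I
  · rintro ⟨M, hM⟩
    haveI := finite_quotient_maximalIdeal_pow (σ := σ) (K := κ) M
    refine Module.Finite.of_surjective
      (Ideal.Quotient.factorₐ κ hM : (MvPowerSeries σ κ ⧸ maximalIdeal (MvPowerSeries σ κ) ^ M) →ₗ[κ]
        MvPowerSeries σ κ ⧸ I) ?_
    exact Ideal.Quotient.factor_surjective hM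

/-- **Finiteness of `κ⟦X⟧ ⧸ I` is invariant under bijective ring endomorphisms** (they fix the maximal ideal).
[folklore] -/
theorem finite_quotient_map_of_bijective {σ : Type} [Finite σ] {φ : MvPowerSeries σ κ →+* MvPowerSeries σ κ}
    (hφ : Function.Bijective φ) (I : Ideal (MvPowerSeries σ κ)) (h : Module.Finite κ (MvPowerSeries σ κ ⧸ I)) :
    Module.Finite κ (MvPowerSeries σ κ ⧸ I.map φ) := by
  rw [finite_quotient_iff_exists_pow_le] at h ⊢
  obtain ⟨M, hM⟩ := h
  have hmax : (maximalIdeal (MvPowerSeries σ κ)).map φ = maximalIdeal (MvPowerSeries σ κ) :=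
    IsLocalRing.eq_maximalIdeal
      (Ideal.IsMaximal.map_bijective (f := φ) hφ (IsLocalRing.maximalIdeal.isMaximal (MvPowerSeries σ κ)))
  refine ⟨M, ?_⟩
  calc maximalIdeal (MvPowerSeries σ κ) ^ M = ((maximalIdeal (MvPowerSeries σ κ)).map φ) ^ M := by rw [hmax]
    _ = (maximalIdeal (MvPowerSeries σ κ) ^ M).map φ := (Ideal.map_pow φ _ M).symm
    _ ≤ I.map φ := Ideal.map_mono hM

/-- Finiteness of `κ⟦X⟧ ⧸ I` is invariant under `map` along a field automorphism of `κ`. [folklore] -/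
theorem finite_quotient_map_iff {σ : Type} [Finite σ] (s : κ ≃+* κ) (I : Ideal (MvPowerSeries σ κ)) :
    Module.Finite κ (MvPowerSeries σ κ ⧸ I.map (map (σ := σ) (s : κ →+* κ))) ↔
      Module.Finite κ (MvPowerSeries σ κ ⧸ I) := by
  refine ⟨fun h => ?_, finite_quotient_map_of_bijective (map_bijective s) I⟩
  have h' := finite_quotient_map_of_bijective (map_bijective s.symm) _ h
  rwa [Ideal.map_map, ← map_comp, RingEquiv.symm_comp, map_id, Ideal.map_id] at h'

/-! ## The Tjurina algebra under arbitrary ring automorphisms -/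

/-- [OURS · L1 W4.6 — DICTIONARY, Isol is intrinsic under RING automorphisms; NOT a statement of the manuscript]
Over a perfect field `κ` of characteristic `p`, for every RING automorphism `θ` of `κ⟦X₁,…,X_m⟧` and every unit `w`:
`κ⟦X⟧/T(w·θF)` is finite over `κ` iff `κ⟦X⟧/T(F)` is (`T(G) = (G) + (∂G/∂X_i)_i` the Tjurina ideal). [folklore] -/
theorem finite_tjurina_iff_of_ringEquiv (p : ℕ) [Fact p.Prime] [CharP κ p] [PerfectRing κ p] {m : ℕ}
    (θ : MvPowerSeries (Fin m) κ ≃+* MvPowerSeries (Fin m) κ) (F w : MvPowerSeries (Fin m) κ) (hw : IsUnit w) :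
    Module.Finite κ (MvPowerSeries (Fin m) κ ⧸
        (Ideal.span {w * θ F} ⊔ Ideal.span (Set.range fun j : Fin m => pd j (w * θ F)))) ↔
      Module.Finite κ (MvPowerSeries (Fin m) κ ⧸
        (Ideal.span {F} ⊔ Ideal.span (Set.range fun i : Fin m => pd i F))) := by
  obtain ⟨s, θ', hθ⟩ := exists_algEquiv_forall_eq p θ
  rw [hθ F, finite_tjurina_iff_of_algEquiv θ' _ w hw, tjurina_map_eq_map, finite_quotient_map_iff]

/-- [OURS · L1 W4.6 — DICTIONARY, Isol is intrinsic under RING automorphisms, germ index `Option (Fin n)` of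
`κ⟦z,u⟧`; NOT a statement of the manuscript] The same for the index type of bricks 2–3 and of the forced-atom rung.
[folklore] -/
theorem finite_tjurina_iff_of_ringEquiv_option (p : ℕ) [Fact p.Prime] [CharP κ p] [PerfectRing κ p] {n : ℕ}
    (θ : MvPowerSeries (Option (Fin n)) κ ≃+* MvPowerSeries (Option (Fin n)) κ)
    (F w : MvPowerSeries (Option (Fin n)) κ) (hw : IsUnit w) :
    Module.Finite κ (MvPowerSeries (Option (Fin n)) κ ⧸
        (Ideal.span {w * θ F} ⊔ Ideal.span (Set.range fun j : Option (Fin n) => pd j (w * θ F)))) ↔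
      Module.Finite κ (MvPowerSeries (Option (Fin n)) κ ⧸
        (Ideal.span {F} ⊔ Ideal.span (Set.range fun i : Option (Fin n) => pd i F))) := by
  obtain ⟨s, θ', hθ⟩ := exists_algEquiv_forall_eq p θ
  rw [hθ F, finite_tjurina_iff_of_algEquiv_option θ' _ w hw, tjurina_map_eq_map, finite_quotient_map_iff]

end CampaignW46.AtomGerm

end Summit.ResolutionOfSingularities.ResolutionOfSingularities.Theorems

end
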